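import Summits.Ventures.CertifiedArithmetic.LowPrec.GemmTerminalConstant

/-!
# A finite graph certificate bounds the defect `1 - W(n)` for every `n` (Prop. Θ(i), soundness)

HONEST FRAMING (venture CertifiedArithmetic / cell `pub-lowprec`, seat gemm, gen 6): certified error
envelopes and provably optimal rounding/accumulation schemes for low-precision formats under stated
cost models; every table by two implementations; no hardware or vendor claims.

Paper `gemm.tex` §Regimes, Prop. "the terminal constant bounds the defect for every n" (i).
`GemmTerminalConstant.lean` reduced the bound `θ/(m + θ(1+β̄)) ≤ 1 - (ŝ_m - Σx)/Σ|x|` to two facts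
about the walk (`hM`: the moving steps gain at most `β̄` times their deficit; `hC`: an absorption gains
at most `D_{<j}/θ`).  THIS FILE derives both facts — for every input over an alphabet `Λ` and every
length — from SEVEN FINITE FACTS about the one-step map `fl(v + q)` on a set of states `S ⊇ Λ`
carrying a potential `ψ` (`ThetaCertificate`): closure of `S`; `ψ(q) ≤ |q|` at the start;
`ψ(w) ≤ ψ(v) + d` along every move `v → w` (`d = |q| - δ`, `δ = w - v - q`); `θ|q| ≤ ψ(v)` at every
absorption of a negative letter; `δ ≤ ρ d` on paid moves (`d > 0`); and for every free move
(`d = 0`) `δ ≤ κ ψ(v)` and `δ + δ' ≤ β_pair d'` for every next move.  Conclusion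
(`ThetaCertificate.defect_bound`): the bound of Prop. Θ(i) with `β̄ = max(ρ, β_pair) + κ`.
The proof is one induction along the walk (`walk_invariant`) with the bookkeeping of the paper's
Lemma "moving walks": the moving deficit `D^mov` dominates the potential, the moving gain is at most
`max(ρ,β_pair) · D^mov` plus the PENDING gain of a trailing free move (itself `≤ κ D^mov`), and the
absorbed gain is at most `(#absorptions) · D / θ` (`absGain_bound`).  For a concrete configuration the
seven facts are decidable and are discharged by `decide` on the reachable graph
(`GemmThetaE2M1Data.lean`, `GemmThetaE2M1.lean`: E2M1²→bfloat16, the first kernel-checked UPPER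
bound on `W(n)` valid for every `n`).
-/

namespace Literature.ComputerArithmetic.FloatingPoint

namespace MiniFloat

open Finset

variable {α : Format}

/-! ### One step of the walk graph -/

/-- The one-step map of sequential accumulation: `fl(v + q)` as a rational. [cell, gemm.tex §Regimes] -/
def flStep (α : Format) (v q : ℚ) : ℚ := (roundNE α (v + q)).toRat

/-- Gain of the step `v → fl(v+q)`: `δ = fl(v+q) - (v + q)`. [cell, gemm.tex §Regimes] -/
def gainOf (α : Format) (v q : ℚ) : ℚ := flStep α v q - (v + q)

/-- Deficit of the step: `d = |q| - δ`. [cell, gemm.tex §Regimes] -/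
def deficitOf (α : Format) (v q : ℚ) : ℚ := |q| - gainOf α v q

/-- A θ-CERTIFICATE for the alphabet `Λ` in format `α`: a set of states `S`, a potential `ψ` and
constants `θ > 0`, `ρ, β_pair, κ ≥ 0` satisfying the seven finite facts of the paper's proof of
Prop. Θ(i) (start, closure, potential, capacity, paid moves, free moves with their successors).
[cell, gemm.tex §Regimes Prop. Θ and Lemma "moving walks"] -/
structure ThetaCertificate (α : Format) (Λ S : ℚ → Prop) (ψ : ℚ → ℚ) (θ ρ βp κ : ℚ) : Prop where
  /-- `θ > 0` -/
  θ_pos : 0 < θ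
  /-- `ρ ≥ 0` -/
  ρ_nonneg : 0 ≤ ρ
  /-- `β_pair ≥ 0` -/
  βp_nonneg : 0 ≤ βp
  /-- `κ ≥ 0` -/
  κ_nonneg : 0 ≤ κ
  /-- every letter is a value of `α`, a state, and has potential at most its mass -/
  start : ∀ q, Λ q → (∃ y : MiniFloat α, y.toRat = q) ∧ S q ∧ ψ q ≤ |q|
  /-- `S` is closed under every letter -/
  closed : ∀ v q, S v → Λ q → S (flStep α v q)
  /-- along a move the potential grows at most by the deficit -/
  potential : ∀ v q, S v → Λ q → flStep α v q ≠ v → ψ (flStep α v q) ≤ ψ v + deficitOf α v q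
  /-- an absorbed negative letter has mass at most `ψ/θ` -/
  capacity : ∀ v q, S v → Λ q → flStep α v q = v → q < 0 → θ * -q ≤ ψ v
  /-- a paid move gains at most `ρ` times its deficit -/
  paid : ∀ v q, S v → Λ q → flStep α v q ≠ v → 0 < deficitOf α v q →
    gainOf α v q ≤ ρ * deficitOf α v q
  /-- a free move gains at most `κ ψ`, and together with any next move at most `β_pair d'` -/
  free : ∀ u q, S u → Λ q → flStep α u q ≠ u → deficitOf α u q = 0 →
    gainOf α u q ≤ κ * ψ u ∧
      ∀ q', Λ q' → flStep α (flStep α u q) q' ≠ flStep α u q →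
        gainOf α u q + gainOf α (flStep α u q) q' ≤ βp * deficitOf α (flStep α u q) q'

/-! ### Bookkeeping along the walk -/

/-- Value of the accumulator after step `j`. [cell] -/
def sv (α : Format) (x : ℕ → ℚ) (j : ℕ) : ℚ := (seqSum α x j).toRat

/-- The walk steps by `flStep`. [folklore] -/
theorem sv_succ (x : ℕ → ℚ) (j : ℕ) : sv α x (j + 1) = flStep α (sv α x j) (x (j + 1)) := rfl

/-- `stepGain (j+1)` is the gain of the edge taken. [folklore] -/
theorem stepGain_succ_eq (x : ℕ → ℚ) (j : ℕ) :
    stepGain α x (j + 1) = gainOf α (sv α x j) (x (j + 1)) := rfl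

/-- `stepDeficit (j+1)` is the deficit of the edge taken. [folklore] -/
theorem stepDeficit_succ_eq (x : ℕ → ℚ) (j : ℕ) :
    stepDeficit α x (j + 1) = deficitOf α (sv α x j) (x (j + 1)) := rfl

/-- Step `j` is an ABSORPTION: `j ≥ 1` and the value does not change. [cell, gemm.tex §Regimes] -/
def absorbedB (α : Format) (x : ℕ → ℚ) : ℕ → Bool
  | 0 => false
  | j + 1 => decide (sv α x (j + 1) = sv α x j)

/-- Deficit of the moving steps `≤ j` (step `0` included). [cell] -/
def movDef (α : Format) (x : ℕ → ℚ) : ℕ → ℚ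
  | 0 => stepDeficit α x 0
  | j + 1 => movDef α x j + if absorbedB α x (j + 1) then 0 else stepDeficit α x (j + 1)

/-- Gain of the moving steps `≤ j`. [cell] -/
def movGain (α : Format) (x : ℕ → ℚ) : ℕ → ℚ
  | 0 => stepGain α x 0
  | j + 1 => movGain α x j + if absorbedB α x (j + 1) then 0 else stepGain α x (j + 1)

/-- Gain of the absorptions `≤ j`. [cell] -/
def absGain (α : Format) (x : ℕ → ℚ) : ℕ → ℚ
  | 0 => 0
  | j + 1 => absGain α x j + if absorbedB α x (j + 1) then stepGain α x (j + 1) else 0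

/-- Number of absorptions `≤ j`. [cell] -/
def absCount (α : Format) (x : ℕ → ℚ) : ℕ → ℕ
  | 0 => 0
  | j + 1 => absCount α x j + if absorbedB α x (j + 1) then 1 else 0

/-- PENDING gain: the gain of the last move if it was free, else `0`. [cell, Lemma "moving walks"] -/
def pend (α : Format) (x : ℕ → ℚ) : ℕ → ℚ
  | 0 => 0
  | j + 1 => if absorbedB α x (j + 1) then pend α x j
      else if stepDeficit α x (j + 1) = 0 then stepGain α x (j + 1) else 0

/-- Total gain = moving gain + absorbed gain. [folklore] -/
theorem sum_stepGain_eq_mov_add_abs (x : ℕ → ℚ) :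
    ∀ j, ∑ i ∈ range (j + 1), stepGain α x i = movGain α x j + absGain α x j
  | 0 => by simp [movGain, absGain]
  | j + 1 => by
      rw [sum_range_succ, sum_stepGain_eq_mov_add_abs x j]
      cases h : absorbedB α x (j + 1) <;> simp [movGain, absGain, h] <;> ring

/-- The moving deficit is at most the total deficit. [folklore] -/
theorem movDef_le_sum (x : ℕ → ℚ) (hd : ∀ i, 0 ≤ stepDeficit α x i) :
    ∀ j, movDef α x j ≤ ∑ i ∈ range (j + 1), stepDeficit α x i
  | 0 => by simp [movDef]
  | j + 1 => by
      rw [sum_range_succ]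
      have ih := movDef_le_sum x hd j
      have h1 := hd (j + 1)
      cases h : absorbedB α x (j + 1) <;> simp [movDef, h] <;> linarith

/-- The moving deficit is nonnegative. [folklore] -/
theorem movDef_nonneg (x : ℕ → ℚ) (hd : ∀ i, 0 ≤ stepDeficit α x i) : ∀ j, 0 ≤ movDef α x j
  | 0 => by simpa [movDef] using hd 0
  | j + 1 => by
      have ih := movDef_nonneg x hd j
      have h1 := hd (j + 1)
      cases h : absorbedB α x (j + 1) <;> simp [movDef, h] <;> linarith

/-- There are at most `j` absorptions among the steps `≤ j`. [folklore] -/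
theorem absCount_le (x : ℕ → ℚ) : ∀ j, absCount α x j ≤ j
  | 0 => by simp [absCount]
  | j + 1 => by
      have ih := absCount_le x j
      cases h : absorbedB α x (j + 1) <;> simp [absCount, h] <;> omega

namespace ThetaCertificate

variable {Λ S : ℚ → Prop} {ψ : ℚ → ℚ} {θ ρ βp κ : ℚ}

/-- Under a certificate the first term is loaded exactly. [folklore] -/
theorem sv_zero (hc : ThetaCertificate α Λ S ψ θ ρ βp κ) (x : ℕ → ℚ) (hx : ∀ j, Λ (x j)) :
    sv α x 0 = x 0 := by
  unfold sv seqSum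
  exact toRat_roundNE_of_exists (hc.start _ (hx 0)).1

/-- Under a certificate every deficit is nonnegative. [folklore] -/
theorem deficit_nonneg (hc : ThetaCertificate α Λ S ψ θ ρ βp κ) (x : ℕ → ℚ) (hx : ∀ j, Λ (x j)) :
    ∀ i, 0 ≤ stepDeficit α x i :=
  stepDeficit_nonneg x (hc.start _ (hx 0)).1

/-- THE WALK INVARIANT (Lemma "moving walks" in inductive form): the state stays in `S`, the
potential is dominated by the moving deficit, the moving gain is at most `max(ρ, β_pair) · D^mov`
plus the pending gain, the pending gain is at most `κ D^mov`, and a nonzero pending gain is the gain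
of a free move into the current state. [cell, gemm.tex §Regimes] -/
theorem walk_invariant (hc : ThetaCertificate α Λ S ψ θ ρ βp κ) (x : ℕ → ℚ) (hx : ∀ j, Λ (x j)) :
    ∀ j, S (sv α x j) ∧ ψ (sv α x j) ≤ movDef α x j ∧
      movGain α x j ≤ max ρ βp * movDef α x j + pend α x j ∧
      pend α x j ≤ κ * movDef α x j ∧
      (pend α x j = 0 ∨ ∃ u q, S u ∧ Λ q ∧ flStep α u q = sv α x j ∧ flStep α u q ≠ u ∧
        deficitOf α u q = 0 ∧ pend α x j = gainOf α u q)
  | 0 => by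
      have h0 := hc.sv_zero x hx
      have hst := hc.start _ (hx 0)
      have hg0 : stepGain α x 0 = 0 := stepGain_zero_of_exists x hst.1
      have hd0 : movDef α x 0 = |x 0| := by simp [movDef, stepDeficit, hg0]
      have hB : 0 ≤ max ρ βp := le_max_of_le_left hc.ρ_nonneg
      refine ⟨by rw [h0]; exact hst.2.1, by rw [h0, hd0]; exact hst.2.2, ?_, ?_, Or.inl rfl⟩
      · simp only [movGain, pend, hg0, hd0, add_zero]
        exact mul_nonneg hB (abs_nonneg _)
      · simp only [pend, hd0]; exact mul_nonneg hc.κ_nonneg (abs_nonneg _)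
  | j + 1 => by
      obtain ⟨hS, hψ, hG, hP, hW⟩ := walk_invariant hc x hx j
      have hd := hc.deficit_nonneg x hx
      have hDm := movDef_nonneg x hd j
      have hB : 0 ≤ max ρ βp := le_max_of_le_left hc.ρ_nonneg
      have hq := hx (j + 1)
      have hw : sv α x (j + 1) = flStep α (sv α x j) (x (j + 1)) := rfl
      have hδ : stepGain α x (j + 1) = gainOf α (sv α x j) (x (j + 1)) := rfl
      have hdd : stepDeficit α x (j + 1) = deficitOf α (sv α x j) (x (j + 1)) := rfl
      by_cases hab : flStep α (sv α x j) (x (j + 1)) = sv α x j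
      · -- absorption: nothing moves
        have hb : absorbedB α x (j + 1) = true := by simp [absorbedB, hw, hab]
        have em : movDef α x (j + 1) = movDef α x j := by simp [movDef, hb]
        have eg : movGain α x (j + 1) = movGain α x j := by simp [movGain, hb]
        have ep : pend α x (j + 1) = pend α x j := by simp [pend, hb]
        rw [hw, hab, em, eg, ep]
        exact ⟨hS, hψ, hG, hP, hW⟩
      · -- a move
        have hb : absorbedB α x (j + 1) = false := by simp [absorbedB, hw, hab]
        have em : movDef α x (j + 1) = movDef α x j + deficitOf α (sv α x j) (x (j + 1)) := by
          simp [movDef, hb, hdd]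
        have eg : movGain α x (j + 1) = movGain α x j + gainOf α (sv α x j) (x (j + 1)) := by
          simp [movGain, hb, hδ]
        have ep : pend α x (j + 1)
            = if deficitOf α (sv α x j) (x (j + 1)) = 0 then gainOf α (sv α x j) (x (j + 1)) else 0 := by
          simp [pend, hb, hdd, hδ]
        have hdnn : 0 ≤ deficitOf α (sv α x j) (x (j + 1)) := by rw [← hdd]; exact hd (j + 1)
        rw [hw, em, eg, ep]
        refine ⟨hc.closed _ _ hS hq, ?_, ?_, ?_, ?_⟩
        · have := hc.potential _ _ hS hq hab; linarith
        · -- moving gain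
          by_cases hd0 : deficitOf α (sv α x j) (x (j + 1)) = 0
          · -- free move now: its gain becomes pending
            have hgain : 0 ≤ gainOf α (sv α x j) (x (j + 1)) := by
              have : deficitOf α (sv α x j) (x (j + 1)) = |x (j + 1)| - gainOf α (sv α x j) (x (j + 1)) := rfl
              rw [this] at hd0; linarith [abs_nonneg (x (j + 1))]
            rw [if_pos hd0, hd0, add_zero]
            rcases hW with h | ⟨u, q₀, hu, hq₀, huv, hne, hd₀, hpend⟩
            · rw [h, add_zero] at hG; linarith
            · have h2 := (hc.free u q₀ hu hq₀ hne hd₀).2 _ hq (by rw [huv]; exact hab)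
              rw [huv, ← hpend, hd0, mul_zero] at h2
              linarith
          · -- paid move now: nothing pending afterwards
            rw [if_neg hd0, add_zero]
            have hpos : 0 < deficitOf α (sv α x j) (x (j + 1)) := lt_of_le_of_ne hdnn (Ne.symm hd0)
            rcases hW with h | ⟨u, q₀, hu, hq₀, huv, hne, hd₀, hpend⟩
            · rw [h, add_zero] at hG
              have h1 := hc.paid _ _ hS hq hab hpos
              have hρB : ρ * deficitOf α (sv α x j) (x (j + 1))
                  ≤ max ρ βp * deficitOf α (sv α x j) (x (j + 1)) :=
                mul_le_mul_of_nonneg_right (le_max_left _ _) hdnn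
              linarith
            · have h2 := (hc.free u q₀ hu hq₀ hne hd₀).2 _ hq (by rw [huv]; exact hab)
              rw [huv, ← hpend] at h2
              have hβB : βp * deficitOf α (sv α x j) (x (j + 1))
                  ≤ max ρ βp * deficitOf α (sv α x j) (x (j + 1)) :=
                mul_le_mul_of_nonneg_right (le_max_right _ _) hdnn
              linarith
        · -- pending gain
          by_cases hd0 : deficitOf α (sv α x j) (x (j + 1)) = 0
          · rw [if_pos hd0, hd0, add_zero]
            have h1 := (hc.free _ _ hS hq hab hd0).1
            have := mul_le_mul_of_nonneg_left hψ hc.κ_nonneg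
            linarith
          · rw [if_neg hd0]
            exact mul_nonneg hc.κ_nonneg (by linarith)
        · -- witness
          by_cases hd0 : deficitOf α (sv α x j) (x (j + 1)) = 0
          · rw [if_pos hd0]
            exact Or.inr ⟨_, _, hS, hq, rfl, hab, hd0, rfl⟩
          · rw [if_neg hd0]; exact Or.inl rfl

/-- ABSORBED GAIN: `θ · (gain of the absorptions ≤ j) ≤ (#absorptions ≤ j) · D_{≤ j}`.
[cell, gemm.tex §Regimes Prop. Θ] -/
theorem absGain_bound (hc : ThetaCertificate α Λ S ψ θ ρ βp κ) (x : ℕ → ℚ) (hx : ∀ j, Λ (x j)) :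
    ∀ j, θ * absGain α x j ≤ absCount α x j * ∑ i ∈ range (j + 1), stepDeficit α x i
  | 0 => by simp [absGain, absCount]
  | j + 1 => by
      have ih := absGain_bound hc x hx j
      have hd := hc.deficit_nonneg x hx
      have hDall : 0 ≤ ∑ i ∈ range (j + 1), stepDeficit α x i := sum_nonneg fun i _ => hd i
      have hmono : ∑ i ∈ range (j + 1), stepDeficit α x i
          ≤ ∑ i ∈ range (j + 1 + 1), stepDeficit α x i := by
        rw [sum_range_succ _ (j + 1)]; linarith [hd (j + 1)]
      have hcnt : (0 : ℚ) ≤ absCount α x j := by positivity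
      obtain ⟨hS, hψ, -, -, -⟩ := hc.walk_invariant x hx j
      have hw : sv α x (j + 1) = flStep α (sv α x j) (x (j + 1)) := rfl
      have hδ : stepGain α x (j + 1) = gainOf α (sv α x j) (x (j + 1)) := rfl
      by_cases hab : flStep α (sv α x j) (x (j + 1)) = sv α x j
      · have hb : absorbedB α x (j + 1) = true := by simp [absorbedB, hw, hab]
        have ea : absGain α x (j + 1) = absGain α x j + gainOf α (sv α x j) (x (j + 1)) := by
          simp [absGain, hb, hδ]
        have ec : absCount α x (j + 1) = absCount α x j + 1 := by simp [absCount, hb]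
        rw [ea, ec, Nat.cast_add, Nat.cast_one]
        have hgain : gainOf α (sv α x j) (x (j + 1)) = -x (j + 1) := by unfold gainOf; rw [hab]; ring
        have hstep : θ * gainOf α (sv α x j) (x (j + 1)) ≤ ∑ i ∈ range (j + 1), stepDeficit α x i := by
          rw [hgain]
          by_cases hq0 : x (j + 1) < 0
          · have h1 := hc.capacity _ _ hS (hx (j + 1)) hab hq0
            have h2 := movDef_le_sum x hd j
            linarith
          · have : θ * -x (j + 1) ≤ 0 := by
              have := hc.θ_pos; nlinarith [not_lt.mp hq0]
            linarith
        nlinarith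
      · have hb : absorbedB α x (j + 1) = false := by simp [absorbedB, hw, hab]
        have ea : absGain α x (j + 1) = absGain α x j := by simp [absGain, hb]
        have ec : absCount α x (j + 1) = absCount α x j := by simp [absCount, hb]
        rw [ea, ec]
        nlinarith

/-- PROP. Θ(i), SOUNDNESS OF THE CERTIFICATE: for every input over `Λ` and every length `n = m + 1`,
`θ/(m + θ(1 + β̄)) ≤ 1 - (ŝ_m - Σ x)/Σ|x|` with `β̄ = max(ρ, β_pair) + κ`.
[cell, gemm.tex §Regimes Prop. Θ(i)] -/
theorem defect_bound (hc : ThetaCertificate α Λ S ψ θ ρ βp κ) (x : ℕ → ℚ) (hx : ∀ j, Λ (x j))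
    (m : ℕ) (hL : 0 < ∑ j ∈ range (m + 1), |x j|) :
    θ / (m + θ * (1 + (max ρ βp + κ)))
      ≤ 1 - ((seqSum α x m).toRat - ∑ j ∈ range (m + 1), x j) / ∑ j ∈ range (m + 1), |x j| := by
  have hd := hc.deficit_nonneg x hx
  have hB : 0 ≤ max ρ βp := le_max_of_le_left hc.ρ_nonneg
  have hβ : 0 ≤ max ρ βp + κ := add_nonneg hB hc.κ_nonneg
  have hD : 0 ≤ ∑ i ∈ range (m + 1), stepDeficit α x i := sum_nonneg fun i _ => hd i
  obtain ⟨-, -, hG, hP, -⟩ := hc.walk_invariant x hx m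
  have hA := hc.absGain_bound x hx m
  have hsplit := sum_stepGain_eq_mov_add_abs (α := α) x m
  rw [sum_stepGain] at hsplit
  have hmov := movDef_le_sum x hd m
  have hθ := hc.θ_pos
  have hkey : θ * ((seqSum α x m).toRat - ∑ j ∈ range (m + 1), x j)
      ≤ (θ * (max ρ βp + κ) + (absCount α x m : ℕ)) * ∑ i ∈ range (m + 1), stepDeficit α x i := by
    rw [hsplit]
    have h1 : movGain α x m ≤ (max ρ βp + κ) * movDef α x m := by nlinarith
    have h2 : (max ρ βp + κ) * movDef α x m ≤ (max ρ βp + κ) * ∑ i ∈ range (m + 1), stepDeficit α x i :=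
      mul_le_mul_of_nonneg_left hmov hβ
    nlinarith
  exact theta_div_le_one_sub_ratio hθ hβ hD hL (sum_abs_eq_gain_add_deficit x m) hkey (absCount_le x m)

/-- The same bound as an upper bound on the relative signed error. [cell, gemm.tex Prop. Θ(i)] -/
theorem ratio_le (hc : ThetaCertificate α Λ S ψ θ ρ βp κ) (x : ℕ → ℚ) (hx : ∀ j, Λ (x j))
    (m : ℕ) (hL : 0 < ∑ j ∈ range (m + 1), |x j|) :
    ((seqSum α x m).toRat - ∑ j ∈ range (m + 1), x j) / ∑ j ∈ range (m + 1), |x j|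
      ≤ 1 - θ / (m + θ * (1 + (max ρ βp + κ))) := by
  have := hc.defect_bound x hx m hL
  linarith

end ThetaCertificate

end MiniFloat

end Literature.ComputerArithmetic.FloatingPoint
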